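import Literature.MathematicalPhysics.QuantumFieldTheory.Balaban1983to89.B15Claim189UnitTestAtRecord

/-!
# `Balaban1983to89.B15Claim189NumericsPin` — YM-DAG node N12 · [Balaban1989LargeFieldI] CMP **122** (1989) 175–202, (1.89) p. 198 with p. 177 (conditions (i)–(ii)),
# p. 178 (`h = k − N`), p. 181 (`k₀ = k − N₀`), p. 194 (Prop. 1: `B₅M⁵ε`), p. 195 ((1.80): `M⁵`), p. 199 (`α = 1/12`): THE NUMBERS OF THE (1.89) SITUATION THAT ARE
# OBJECTS OF RECORD OR PRINT'S FIXED CONSTANTS, PINNED — `M :=` [I]'s basic cube size of record (`TowerNumerics.M`, the `M` of the `M R_k`-cubes), `α := 1/12`,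
# `h := k − N` with condition (ii)'s memory `N = TowerNumerics.Nmem`, `k₀ := k − N₀` (print's `N₀`, a parameter) — and the numerics inputs of module 4's display
# theorem DISCHARGED at the pin; the fully-lettered pin `ResidW.pinD189ν` (numbers, then `χ′`, then `dev0`) with the unit-configuration test of modules 7–9

statement-level bookkeeping over published theorems with citation tags; kernel-checked compositions of tree theorems; nothing here is a claim about the Yang–Mills
mass gap.

CITATION HEADER (lean-in-tree rule).  Source: [Balaban1989LargeFieldI] («[IV]»): p. 177 (*"(i) it is contained in a cube of the size 100 MR_k, (ii) in the preceding N
renormalization steps no new large field regions were created inside this component"*), p. 178 (*"where h = k − N, and we have written explicitly the first and the last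
characteristic functions in the product of the last N one-step operations"*), p. 181 (*"for j = h + n ≦ k₀ = k − N₀"*), Prop. 1 p. 194 (*"|V_Λ(∂p′) − 1| < B₅M⁵ε"*),
p. 195 (*"The constant B₅ is determined by the geometry of the problem, more precisely by the condition (i). The power M⁵ is not the optimal one"*; (1.80)), p. 199
(*"We have chosen α = 1/12 in (1.91), (1.94), (1.95)"*), (1.89) p. 198; [Balaban1988Convergent] (2.1) p. 254 (the `M R_j`-cubes).  Seat `pub-ymgap-dag-n12-e` (YM-PLAN
Track A, HUMAN RULING D-0062; director-ym R134 row N12 s3), module 10 (generation 3).  BY NAME and UNCHANGED: def-R's `Node00.TowerNumerics` (`M`, `Nmem`; fields of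
`Stage9Params.τ9`), module 4 `B15Claim189PinAtRecord` (`Sit189`, `D189OfRecord`, `ResidW.pinD189`), modules 7–9 (`Sit189.pinChi182`, `deltaPrimeOfRecord`, `Sit189.pinDev0`,
`ResidW.pinD189χ₀`, `displays_tested_at_one_of_admissible`).

WHY THIS FILE.  Module 4 left ALL of print's numbers of the (1.89) situation residual (`β, L₀, α, δ, B₃, B₅, M, O(1)`, the levels `h ≤ k₀ ≤ k`).  Four of them are not
free: `M` is [I]'s basic cube size — the SAME `M` as in the `M R_k`-cubes of condition (i), in Proposition 1's `B₅M⁵ε` and in (1.80)'s `M⁵` (p. 195 ties `B₅` and the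
power of `M` to condition (i)) — an object of record, def-R's `TowerNumerics.M`; `α` is FIXED by print to `1/12` (p. 199); `h = k − N` (p. 178) with `N` the memory of
condition (ii), def-R's `TowerNumerics.Nmem`; `k₀ = k − N₀` (p. 181) with print's second memory `N₀` (not a numeric of the record: a parameter).  Pinning them shrinks
the residual situation to (`k`; regions; cube data; `β, L₀, δ, B₃, B₅, O(1)`; `dist`; `devV″, dev97`) and turns four numerics inputs of module 4's display theorem
(`hα`, `hM`, `hhk : h ≤ k₀`, `hk₀ : k₀ + 2 ≤ k`) into arithmetic of `N₀ ≤ N`, `2 ≤ N₀ ≤ k`.  ORDER OF PINS: the (1.82) instance of module 7 READS the levels `h, k`, so the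
numbers are pinned FIRST, then `χ′`, then `dev0` (`ResidW.pinD189ν`); the top level `k` itself stays residual pending the definers' word on the dictionary «(1.89)'s k =
the W pin's `kSel P + 1`» (QUESTION-1 on the bus, 2026-08-27).

WHAT THIS FILE PROVES (0 `sorry`; defs `Node00.Sit189.pinNumerics`, `Node00.ResidW.pinD189ν`).
§1 `Sit189.pinNumerics σ τ N₀` + `rfl` faces (`_M`, `_α`, `_h`, `_k₀`, `_k`, `_regions`, `_cubes`, `_numbers_kept`, `_𝔤`), the arithmetic `pinNumerics_h_le_k`,
   `pinNumerics_h_le_k₀` (`N₀ ≤ N`), `pinNumerics_k₀_add_two_le_k` (`2 ≤ N₀ ≤ k`), `pinNumerics_α_eq`, `pinNumerics_M_nonneg`, `pinNumerics_B_nonneg` (the sign input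
   `0 ≤ O(1)B₃B₅M⁵` from `0 ≤ O(1)B₃B₅`), `pinNumerics_pinDev0_comm` (`rfl`), `chiP_pinNumerics_pinChi182_iff` (the χ′ instance at the PINNED levels).
§2 `ResidW.pinD189ν λ θ σ N₀ p₁ := λ.pinD189χ₀ θ (P ↦ (σ P).pinNumerics θ.τ9 N₀) p₁` + faces (`_eq`, `_D189`, `_kSel_LF_D1100`, `_pinRPrime_comm`), A2 `exists_residW_pinD189ν_pinRPrime`,
   **`displays_tested_at_one_pinD189ν_of_admissible`** (modules 7–9's unit-configuration test at the fully-lettered pin: `h ≤ k` now automatic, the sign input read off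
   `0 ≤ O(1)B₃B₅`).

HONEST FRAMING.  Count-neutral: a data transformer + `rfl` ∕ `omega` bookkeeping; nothing of Bałaban's asserted; N12 NOT discharged; one finite four-torus programme at fixed
`ε`, Bałaban AS PRINTED with locators; nothing continuum ∕ ℝ⁴ ∕ OS ∕ mass gap ∕ Clay.  No `sorry`, no `axiom`, no `instance`, no `notation`.
-/

noncomputable section

open scoped BigOperators
open MeasureTheory

namespace Literature.MathematicalPhysics.QuantumFieldTheory.Balaban1983to89

namespace B15Claim189NumericsPin

open DagBinding T4Continuum Node00
open B15DeterminingSets (MSField)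
open B15Claim189Assembly (Setting189 new189 chiPP dom)
open B15Claim189PinAtRecord (D189OfRecord)
open B15Claim189PinNonVacuity (deltaPrimeOfRecord)
open B15Sect1ChartInstances (bondsB0)
open B15 (Ineq180)
open B8Eq17ClassAkV1 (plaqsOf)

/-! ## §1. The numbers of record ∕ print's constants, pinned -/

section Pin

variable {F : T4Family} {N : ℕ} [NeZero N]

/-- **THE (1.89) SITUATION WITH ITS NUMBERS OF RECORD PINNED**: `M := τ.M` ([I]'s basic cube size, the `M` of the `M R_k`-cubes of condition (i), of Prop. 1's `B₅M⁵ε` and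
of (1.80)'s `M⁵`), `α := 1/12` (p. 199), `h := k − N` with `N := τ.Nmem` (condition (ii)'s memory; p. 178), `k₀ := k − N₀` (p. 181; print's `N₀`, a parameter); everything
else — the top level `k`, regions, cube data, `β, L₀, δ, B₃, B₅, O(1)`, `dist`, the chart letter and the deviation letters — unchanged.  Data, no law.
[cite: Balaban1989LargeFieldI, p.177, p.178, p.181, Prop. 1 p.194, (1.80) p.195, p.199] -/
def _root_.Literature.MathematicalPhysics.QuantumFieldTheory.Balaban1983to89.Node00.Sit189.pinNumerics {K : ℕ} (σ : Sit189 F N K) (τ : TowerNumerics) (N₀ : ℕ) :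
    Sit189 F N K :=
  { σ with M := (τ.M : ℝ), α := 1 / 12, h := σ.k - τ.Nmem, k₀ := σ.k - N₀ }

variable {K : ℕ} (σ : Sit189 F N K) (τ : TowerNumerics) (N₀ : ℕ)

/-- `M` IS the basic cube size of record (`rfl`). [cite: Balaban1989LargeFieldI, p.177 (condition (i)), (1.80) p.195] -/
theorem pinNumerics_M : (σ.pinNumerics τ N₀).M = (τ.M : ℝ) := rfl

/-- `α = 1/12` (`rfl`). [cite: Balaban1989LargeFieldI, p.199] -/
theorem pinNumerics_α : (σ.pinNumerics τ N₀).α = 1 / 12 := rfl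

/-- `h = k − N` (`rfl`). [cite: Balaban1989LargeFieldI, p.178] -/
theorem pinNumerics_h : (σ.pinNumerics τ N₀).h = σ.k - τ.Nmem := rfl

/-- `k₀ = k − N₀` (`rfl`). [cite: Balaban1989LargeFieldI, (1.24) p.181] -/
theorem pinNumerics_k₀ : (σ.pinNumerics τ N₀).k₀ = σ.k - N₀ := rfl

/-- The top level is unchanged (`rfl`). [cite: Balaban1989LargeFieldI, (1.89) p.198 (bookkeeping)] -/
theorem pinNumerics_k : (σ.pinNumerics τ N₀).k = σ.k := rfl

/-- The chart carrier is unchanged (`rfl`). [cite: Balaban1989LargeFieldI, (1.82) p.196 (bookkeeping)] -/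
theorem pinNumerics_𝔤 : (σ.pinNumerics τ N₀).𝔤 = σ.𝔤 := rfl

/-- The regions are unchanged (`rfl`). [cite: Balaban1989LargeFieldI, (1.12) p.179, (1.81) p.195 (bookkeeping)] -/
theorem pinNumerics_regions : (σ.pinNumerics τ N₀).Ω = σ.Ω ∧ (σ.pinNumerics τ N₀).Zpp = σ.Zpp ∧ (σ.pinNumerics τ N₀).Z = σ.Z ∧ (σ.pinNumerics τ N₀).Λ = σ.Λ ∧
    (σ.pinNumerics τ N₀).OmT = σ.OmT ∧ (σ.pinNumerics τ N₀).ΩppT2 = σ.ΩppT2 := ⟨rfl, rfl, rfl, rfl, rfl, rfl⟩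

/-- The cube data and the deviation letters are unchanged (`rfl`). [cite: Balaban1989LargeFieldI, (1.88)–(1.90) pp.197–198 (bookkeeping)] -/
theorem pinNumerics_cubes : (σ.pinNumerics τ N₀).sh = σ.sh ∧ (σ.pinNumerics τ N₀).sk = σ.sk ∧ (σ.pinNumerics τ N₀).Xhalf = σ.Xhalf ∧ (σ.pinNumerics τ N₀).XH = σ.XH ∧
    (σ.pinNumerics τ N₀).XΩ4 = σ.XΩ4 ∧ (σ.pinNumerics τ N₀).boxOf = σ.boxOf ∧ (σ.pinNumerics τ N₀).dev0 = σ.dev0 ∧ (σ.pinNumerics τ N₀).devV'' = σ.devV'' ∧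
    (σ.pinNumerics τ N₀).dev97 = σ.dev97 := ⟨rfl, rfl, rfl, rfl, rfl, rfl, rfl, rfl, rfl⟩

/-- The residual numbers `β, L₀, δ, B₃, B₅, O(1)` and `dist` are unchanged (`rfl`). [cite: Balaban1989LargeFieldI, (1.24) p.182, (1.80) p.195 (bookkeeping)] -/
theorem pinNumerics_numbers_kept : (σ.pinNumerics τ N₀).β = σ.β ∧ (σ.pinNumerics τ N₀).L₀ = σ.L₀ ∧ (σ.pinNumerics τ N₀).δ = σ.δ ∧ (σ.pinNumerics τ N₀).B₃ = σ.B₃ ∧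
    (σ.pinNumerics τ N₀).B₅ = σ.B₅ ∧ (σ.pinNumerics τ N₀).O1 = σ.O1 ∧ (σ.pinNumerics τ N₀).dist = σ.dist := ⟨rfl, rfl, rfl, rfl, rfl, rfl, rfl⟩

/-- **`h ≤ k` IS AUTOMATIC** at the pin (`k − N ≤ k`). [cite: Balaban1989LargeFieldI, p.178] -/
theorem pinNumerics_h_le_k : (σ.pinNumerics τ N₀).h ≤ (σ.pinNumerics τ N₀).k := Nat.sub_le _ _

/-- **Module 4's `hhk : h ≤ k₀`** at the pin ⇐ `N₀ ≤ N` (print: `j = h + n ≦ k₀ = k − N₀` for the first `N − N₀` integrations). [cite: Balaban1989LargeFieldI, p.181] -/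
theorem pinNumerics_h_le_k₀ (hN : N₀ ≤ τ.Nmem) : (σ.pinNumerics τ N₀).h ≤ (σ.pinNumerics τ N₀).k₀ := Nat.sub_le_sub_left hN _

/-- **Module 4's `hk₀ : k₀ + 2 ≤ k`** at the pin ⇐ `2 ≤ N₀ ≤ k` (print's `N₀ − 1 ≧ 1` on p. 200 and enough preceding steps). [cite: Balaban1989LargeFieldI, p.181, p.200] -/
theorem pinNumerics_k₀_add_two_le_k (h2 : 2 ≤ N₀) (hk : N₀ ≤ σ.k) : (σ.pinNumerics τ N₀).k₀ + 2 ≤ (σ.pinNumerics τ N₀).k := by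
  show σ.k - N₀ + 2 ≤ σ.k
  omega

/-- **Module 4's `hα : α = 1/12`** at the pin (`rfl`). [cite: Balaban1989LargeFieldI, p.199] -/
theorem pinNumerics_α_eq : (σ.pinNumerics τ N₀).α = 1 / 12 := rfl

/-- **Module 4's `hM : 0 ≤ M`** at the pin (a natural number). [cite: Balaban1989LargeFieldI, (1.80) p.195 (bookkeeping)] -/
theorem pinNumerics_M_nonneg : 0 ≤ (σ.pinNumerics τ N₀).M := Nat.cast_nonneg _

/-- **Module 4's sign input `hB : 0 ≤ O(1)B₃B₅M⁵`** at the pin from the residual sign `0 ≤ O(1)B₃B₅` (`M ≥ 0`). [cite: Balaban1989LargeFieldI, (1.80) p.195 (bookkeeping)] -/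
theorem pinNumerics_B_nonneg (hB : 0 ≤ σ.O1 * σ.B₃ * σ.B₅) :
    0 ≤ (σ.pinNumerics τ N₀).O1 * (σ.pinNumerics τ N₀).B₃ * (σ.pinNumerics τ N₀).B₅ * (σ.pinNumerics τ N₀).M ^ 5 :=
  mul_nonneg hB (pow_nonneg (Nat.cast_nonneg _) 5)

/-- The numbers pin commutes with module 8's `dev0` pin (`rfl`: `dev0OfRecord` reads `Z, Λ, k` only). [cite: Balaban1989LargeFieldI, (1.80) p.195 (bookkeeping)] -/
theorem pinNumerics_pinDev0_comm (ν : Stage7Numerics) : (σ.pinDev0 ν).pinNumerics τ N₀ = (σ.pinNumerics τ N₀).pinDev0 ν := rfl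

/-- **ORDER OF PINS — the (1.82) instance READS the levels**: module 7's χ′-pin applied AFTER the numbers pin tests `|B′(b)| < δ′` on the bonds of `𝔹₀` built with the PINNED
bottom level `h = k − N` (`Iff.rfl`); applied before, it would keep the residual `h`. [cite: Balaban1989LargeFieldI, (1.82) p.196, (1.81) p.195, p.178] -/
theorem chiP_pinNumerics_pinChi182_iff (δ' : ℝ) (B' : (j : ℕ) → VecField (F.P K) j (EuclideanSpace ℝ (Fin (N ^ 2 - 1)))) :
    ((σ.pinNumerics τ N₀).pinChi182 δ').chiP B' ↔ ∀ j, ∀ b ∈ bondsB0 σ.Ω σ.Zpp σ.Z σ.Λ σ.ΩppT2 (σ.k - τ.Nmem) σ.k j, ‖B' j b‖ < δ' := Iff.rfl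

end Pin

/-! ## §2. The fully-lettered pin: numbers, then `χ′` (module 7), then `dev0` (module 8); the unit-configuration test (module 9) -/

section Layer

variable {F : T4Family} {N : ℕ} [NeZero N]

/-- **THE RESIDUAL [IV] LAYER WITH THE (1.89) LETTERS PINNED TO THE RECORD'S OBJECTS: numbers of record (`M`, `α`, `h = k − N`, `k₀ = k − N₀`), THEN the (1.82) instance
with `δ′_k` of record, THEN the (1.80) deviation of record** — module 8's `pinD189χ₀` at the numerics-pinned situations.  Data, no law.
[cite: Balaban1989LargeFieldI, (1.89) p.198, (1.82) p.196, (1.80) p.195, p.178, p.181, p.199] -/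
def _root_.Literature.MathematicalPhysics.QuantumFieldTheory.Balaban1983to89.Node00.ResidW.pinD189ν (lam : ResidW F N) (θ : Stage9Params F N)
    (σ : ∀ P : B12.RunParams, Sit189 F N P.K) (N₀ p₁ : ℕ) : ResidW F N :=
  lam.pinD189χ₀ θ (fun P => (σ P).pinNumerics θ.τ9 N₀) p₁

variable (lam : ResidW F N) (θ : Stage9Params F N) (σ : ∀ P : B12.RunParams, Sit189 F N P.K) (N₀ p₁ : ℕ)

/-- Unfolding (`rfl`). [cite: Balaban1989LargeFieldI, (1.89) p.198 (bookkeeping)] -/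
theorem pinD189ν_eq : lam.pinD189ν θ σ N₀ p₁ = lam.pinD189χ₀ θ (fun P => (σ P).pinNumerics θ.τ9 N₀) p₁ := rfl

/-- The pinned (1.89) letters at run `P` (`rfl`). [cite: Balaban1989LargeFieldI, (1.89) p.198 (bookkeeping)] -/
theorem pinD189ν_D189 (P : B12.RunParams) :
    (lam.pinD189ν θ σ N₀ p₁).D189 P
      = D189OfRecord θ P ((((σ P).pinNumerics θ.τ9 N₀).pinChi182 (deltaPrimeOfRecord F N θ P p₁ (σ P).k)).pinDev0 θ.ν) := rfl

/-- The pin keeps the step selector, the Proposition-1 carrier and the (1.100) data (`rfl`). [cite: Balaban1989LargeFieldI, (0.2) p.176, Prop. 1 p.194, (1.100) p.201 (bookkeeping)] -/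
theorem pinD189ν_kSel_LF_D1100 : (lam.pinD189ν θ σ N₀ p₁).kSel = lam.kSel ∧ (lam.pinD189ν θ σ N₀ p₁).LF = lam.LF ∧ (lam.pinD189ν θ σ N₀ p₁).D1100 = lam.D1100 :=
  ⟨rfl, rfl, rfl⟩

/-- The pin commutes with module 2's (1.100) pin (`rfl`). [cite: Balaban1989LargeFieldI, (1.89) p.198, (1.100) p.201 (bookkeeping)] -/
theorem pinD189ν_pinRPrime_comm : (lam.pinD189ν θ σ N₀ p₁).pinRPrime θ = (lam.pinRPrime θ).pinD189ν θ σ N₀ p₁ := rfl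

/-- The levels of the pinned letters: bottom `k − N`, middle `k − N₀`, top `k` (`rfl`). [cite: Balaban1989LargeFieldI, p.178, p.181] -/
theorem pinD189ν_levels (P : B12.RunParams) :
    ((lam.pinD189ν θ σ N₀ p₁).D189 P).h = (σ P).k - θ.τ9.Nmem ∧ ((lam.pinD189ν θ σ N₀ p₁).D189 P).k₀ = (σ P).k - N₀ ∧ ((lam.pinD189ν θ σ N₀ p₁).D189 P).k = (σ P).k :=
  ⟨rfl, rfl, rfl⟩

/-- The numbers of the pinned letters: `M = τ9.M`, `α = 1/12`, `O(1)·B₃·B₅·M⁵` with the record's `M` (`rfl`). [cite: Balaban1989LargeFieldI, (1.80) p.195, p.199] -/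
theorem pinD189ν_numbers (P : B12.RunParams) :
    ((lam.pinD189ν θ σ N₀ p₁).D189 P).M = (θ.τ9.M : ℝ) ∧ ((lam.pinD189ν θ σ N₀ p₁).D189 P).α = 1 / 12 := ⟨rfl, rfl⟩

variable (F N) in
/-- **A2 — fully-lettered doubly pinned layers EXIST** for every parameter, situation family, `N₀`, `p₁`. [cite: Balaban1989LargeFieldI, (1.89) p.198, (1.100) p.201 (bookkeeping witness)] -/
theorem exists_residW_pinD189ν_pinRPrime (θ : Stage9Params F N) (σ : ∀ P : B12.RunParams, Sit189 F N P.K) (N₀ p₁ : ℕ) :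
    ∃ lam : ResidW F N, (lam.pinD189ν θ σ N₀ p₁).pinRPrime θ = lam :=
  let ⟨lam₀⟩ := nonempty_residW F N
  ⟨(lam₀.pinD189ν θ σ N₀ p₁).pinRPrime θ, rfl⟩

variable {θ} in
/-- **BOTH [IV] DISPLAYS TESTED AT THE UNIT CONFIGURATION AT THE FULLY-LETTERED PIN** (module 9's `displays_tested_at_one_of_admissible` with `h ≤ k` now automatic and the
sign input read off `0 ≤ O(1)B₃B₅`): in the window `]0, γ]` (`γ < 1`) at admissible `θ` with `A₁ > 0`, for a run `P` and a situation with `σ.k ≤ n`, `0 ≤ β < 1`,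
`0 < L₀`, at `U = (1, 0)`: `new189` HOLDS, the (1.80) body HOLDS, the consequent `χ″_k` of (1.89) HOLDS. [cite: Balaban1989LargeFieldI, (1.80) p.195, (1.89) p.198, (1.82) p.196, (1.24) p.182 (bookkeeping witness)] -/
theorem displays_tested_at_one_pinD189ν_of_admissible (hθ : θ.Admissible) (hγ1 : θ.γ < 1) (hA₁ : 0 < θ.A₁) (P : B12.RunParams) {n : ℕ}
    (hI : Step.InInterval θ.γ n (gOfRecord₁₀ F N θ P)) (hkn : (σ P).k ≤ n) (hβ0 : 0 ≤ (σ P).β) (hβ1 : (σ P).β < 1) (hL₀ : 0 < (σ P).L₀)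
    (hB : 0 ≤ (σ P).O1 * (σ P).B₃ * (σ P).B₅) :
    new189 ((lam.pinD189ν θ σ N₀ p₁).D189 P) ((1 : MSField (F.P P.K) (SU N)), fun _ _ => (0 : EuclideanSpace ℝ (Fin (N ^ 2 - 1)))) ∧
    (∀ i, ((lam.pinD189ν θ σ N₀ p₁).D189 P).h ≤ i → i ≤ ((lam.pinD189ν θ σ N₀ p₁).D189 P).k → ∀ q ∈ plaqsOf (dom ((lam.pinD189ν θ σ N₀ p₁).D189 P) i),
      Ineq180 (((lam.pinD189ν θ σ N₀ p₁).D189 P).dev0 ((1 : MSField (F.P P.K) (SU N)), fun _ _ => (0 : EuclideanSpace ℝ (Fin (N ^ 2 - 1)))) q)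
        (((lam.pinD189ν θ σ N₀ p₁).D189 P).ε ((lam.pinD189ν θ σ N₀ p₁).D189 P).k) ((lam.pinD189ν θ σ N₀ p₁).D189 P).η ((lam.pinD189ν θ σ N₀ p₁).D189 P).B₃
        ((lam.pinD189ν θ σ N₀ p₁).D189 P).B₅ ((lam.pinD189ν θ σ N₀ p₁).D189 P).M ((lam.pinD189ν θ σ N₀ p₁).D189 P).δ (((lam.pinD189ν θ σ N₀ p₁).D189 P).dist q)
        ((lam.pinD189ν θ σ N₀ p₁).D189 P).O1) ∧
    chiPP ((lam.pinD189ν θ σ N₀ p₁).D189 P) ((1 : MSField (F.P P.K) (SU N)), fun _ _ => (0 : EuclideanSpace ℝ (Fin (N ^ 2 - 1)))) :=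
  B15Claim189UnitTestAtRecord.displays_tested_at_one_of_admissible lam (fun P => (σ P).pinNumerics θ.τ9 N₀) p₁ hθ hγ1 hA₁ P hI
    (pinNumerics_h_le_k (σ P) θ.τ9 N₀) hkn hβ0 hβ1 hL₀ (pinNumerics_B_nonneg (σ P) θ.τ9 N₀ hB)

end Layer

end B15Claim189NumericsPin

end Literature.MathematicalPhysics.QuantumFieldTheory.Balaban1983to89

end
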